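import Mathlib
import Summits.PneNP.PneNP.Theorems.CnfIdealGenLengthRankDefectRepresentationsTwoFamilyCutDomination
import Summits.PneNP.PneNP.Theorems.CnfIdealGenLengthRankDefectRepresentationsDoubleMaxCutTwoClasses

/-!
# Crux `RankDefectRepresentations` (stmt-PneNP-18923), line `rank-dehn-ladder`: STRIP COMPLETION (lead g11, RESHAPE 6,
# registered stub `stub_stripCompletion`)

Second step of the ANCHOR METHOD for the two-dimensional max-cut decomposition.  Rows and columns carry two colours (`colourI`,
`colourJ`); an entry is VISIBLE when both colours differ; `doubleCut B B′` bounds the four bi-separated rectangle blocks.  If a matrix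
`E` with all double cuts `≤ c` VANISHES at every visible entry off four label strips — rows with I-colour in `PI` or J-colour in `QJ`,
columns with I-colour in `PI′` or J-colour in `QJ′`, each of `≤ m` classes — then some `L` of rank `≤ 32·m·c` agrees with `E` at every
visible entry.  Proof: `E` restricted (by 0/1 masks) to one strip is a ONE-FAMILY instance — rows of one I-class against the columns of
the other I-classes are coloured by the second family only, etc. — whose two bipartition-cut blocks are diagonal-masked double-cut blocks
(`rank_block_le_doubleCut`), hence of rank `≤ c` each; g7's one-family max-cut decomposition `exists_blockDiagonal_of_cuts_le` (p657204)
then supplies a piece of rank `≤ 8c` that equals the masked `E` at visible entries (`exists_piece`).  The `≤ 4m` pieces (row strips first,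
column strips restricted to the rows off the row strips) add up to `E` at every visible entry.  Together with `stub_anchorExtrapolation`
this gives the class-independent bound `rank L ≤ c + 160c²` (`doubleMaxCut_quadratic_of_stubs` in the skeleton).
HONEST FRAMING: elementary; quadratic in `c`, so it does not close `stub_doubleMaxCutDecomposition`; P ≠ NP is not moved; F-N2 is a
FRONTIER formal rung.
-/

set_option linter.dupNamespace false -- `Summit.PneNP.PneNP.…`: summit = sub-problem name (D-0017)

namespace Summit.PneNP.PneNP.Theorems.CnfIdealGenLengthRankDefectRepresentationsStripCompletion

open Matrix
open Summit.PneNP.PneNP.Theorems.CnfIdealGenLengthRankDefectRepresentationsTwoFamilyCutDomination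
  (colourI colourJ maskJ doubleCut)
open Summit.PneNP.PneNP.Theorems.CnfIdealGenLengthRankDefectRepresentationsDoubleMaxCutTwoClasses (exists_blockDiagonal_of_cuts_le)
open Summit.PneNP.PneNP.Theorems.CnfIdealGenLengthRankDefectRepresentationsMergeLowerBound (rank_add_le' rank_sum_le')

variable {K : Type} [Field K] {n n' : ℕ} {ι ι' : Type} [Fintype ι] [Fintype ι'] [DecidableEq ι] [DecidableEq ι']

/-- A 0/1 row-and-column masking is a sandwich between diagonal matrices, so it does not increase the rank. -/
theorem rank_mask_le (pr : ι → Prop) (pc : ι' → Prop) [DecidablePred pr] [DecidablePred pc] (M : Matrix ι ι' K) :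
    (Matrix.of fun x y => if pr x ∧ pc y then M x y else 0).rank ≤ M.rank := by
  classical
  have h : (Matrix.of fun x y => if pr x ∧ pc y then M x y else 0) =
      Matrix.diagonal (fun x => if pr x then (1 : K) else 0) * M * Matrix.diagonal (fun y => if pc y then (1 : K) else 0) := by
    ext x y
    simp only [Matrix.of_apply, Matrix.diagonal_mul, Matrix.mul_diagonal]
    by_cases h1 : pr x <;> by_cases h2 : pc y <;> simp [h1, h2]
  rw [h]
  exact (Matrix.rank_mul_le_left _ _).trans (Matrix.rank_mul_le_right _ _)

section Strips

variable (row : ι → Fin n ⊕ Fin n' → Bool) (col : ι' → Fin n ⊕ Fin n' → Bool) (E : Matrix ι ι' K)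

/-- **A masked bi-separated block is dominated by the double cut.**  If the row predicate forces the I-side `bI` and the J-side `bJ`
(membership in `B`, `B′`) and the column predicate forces the opposite sides, the masked matrix is a diagonal-masking of the sum of
the two double-cut summands, so its rank is at most `doubleCut B B′ E`. -/
theorem rank_block_le_doubleCut (B : Finset (Fin n → Bool)) (B' : Finset (Fin n' → Bool)) (bI bJ : Bool)
    (P : ι → Prop) (Q : ι' → Prop) [DecidablePred P] [DecidablePred Q]
    (hP : ∀ x, P x → ((colourI (row x) ∈ B ↔ bI = true) ∧ (colourJ (row x) ∈ B' ↔ bJ = true)))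
    (hQ : ∀ y, Q y → ((colourI (col y) ∈ B ↔ bI = false) ∧ (colourJ (col y) ∈ B' ↔ bJ = false))) :
    (Matrix.of fun x y => if P x ∧ Q y then E x y else 0).rank ≤ doubleCut row col B B' E := by
  classical
  set M₁ : Matrix ι ι' K :=
    Matrix.of fun x y => if colourI (row x) ∈ B ∧ colourI (col y) ∉ B then maskJ row col B' E x y else 0 with hM₁
  set M₂ : Matrix ι ι' K :=
    Matrix.of fun x y => if colourI (row x) ∉ B ∧ colourI (col y) ∈ B then maskJ row col B' E x y else 0 with hM₂
  have hsum : ∀ x y, P x → Q y → (M₁ + M₂) x y = E x y := by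
    intro x y hx hy
    obtain ⟨h1, h2⟩ := hP x hx
    obtain ⟨h3, h4⟩ := hQ y hy
    have hI : (colourI (row x) ∈ B) ≠ (colourI (col y) ∈ B) := by
      intro h
      rw [h] at h1
      cases bI
      · exact (h1.not.2 (by simp)) (h3.2 rfl)
      · exact (h3.not.2 (by simp)) (h1.2 rfl)
    have hJ : (colourJ (row x) ∈ B') ≠ (colourJ (col y) ∈ B') := by
      intro h
      rw [h] at h2
      cases bJ
      · exact (h2.not.2 (by simp)) (h4.2 rfl)
      · exact (h4.not.2 (by simp)) (h2.2 rfl)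
    simp only [Matrix.add_apply, hM₁, hM₂, maskJ, Matrix.of_apply]
    by_cases hr : colourI (row x) ∈ B
    · have hc : colourI (col y) ∉ B := fun hc => hI (by simp [hr, hc])
      simp [hr, hc, hJ]
    · have hc : colourI (col y) ∈ B := by
        by_contra hc; exact hI (by simp [hr, hc])
      simp [hr, hc, hJ]
  have heq : (Matrix.of fun x y => if P x ∧ Q y then E x y else 0) =
      Matrix.of fun x y => if P x ∧ Q y then (M₁ + M₂) x y else 0 := by
    ext x y
    simp only [Matrix.of_apply]
    by_cases hx : P x
    · by_cases hy : Q y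
      · rw [if_pos ⟨hx, hy⟩, if_pos ⟨hx, hy⟩, hsum x y hx hy]
      · simp [hy]
    · simp [hx]
  rw [heq]
  refine (rank_mask_le P Q (M₁ + M₂)).trans ((rank_add_le' M₁ M₂).trans (le_of_eq ?_))
  rfl

/-- **One-family piece.**  For a colouring `rc, cc` of rows and columns by a finite set `Q₀` and row/column predicates `pr, pc`:
if both bipartition-cut blocks of the masked matrix `E ∘ 1[pr x ∧ pc y]` have rank `≤ c` for every `B ⊆ Q₀`, then a matrix of rank
`≤ 8c` equals the masked matrix at every entry whose colours differ (g7's max-cut decomposition `exists_blockDiagonal_of_cuts_le`). -/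
theorem exists_piece {Q₀ : Type} [Fintype Q₀] [DecidableEq Q₀] (rc : ι → Q₀) (cc : ι' → Q₀)
    (pr : ι → Prop) (pc : ι' → Prop) [DecidablePred pr] [DecidablePred pc] (c : ℕ)
    (hcut : ∀ B : Finset Q₀,
      (Matrix.of fun x y => if (pr x ∧ rc x ∈ B) ∧ (pc y ∧ cc y ∉ B) then E x y else 0).rank ≤ c ∧
      (Matrix.of fun x y => if (pr x ∧ rc x ∉ B) ∧ (pc y ∧ cc y ∈ B) then E x y else 0).rank ≤ c) :
    ∃ L : Matrix ι ι' K, L.rank ≤ 8 * c ∧ ∀ x y, rc x ≠ cc y → L x y = if pr x ∧ pc y then E x y else 0 := by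
  classical
  set R : Matrix ι ι' K := Matrix.of fun x y => if pr x ∧ pc y then E x y else 0 with hR
  have hc2 : ∀ B : Finset Q₀,
      (Matrix.of fun x y => if rc x ∈ B ∧ cc y ∉ B then R x y else 0).rank +
        (Matrix.of fun x y => if rc x ∉ B ∧ cc y ∈ B then R x y else 0).rank ≤ 2 * c := by
    intro B
    have e1 : (Matrix.of fun x y => if rc x ∈ B ∧ cc y ∉ B then R x y else 0) =
        Matrix.of fun x y => if (pr x ∧ rc x ∈ B) ∧ (pc y ∧ cc y ∉ B) then E x y else 0 := by
      ext x y; simp only [hR, Matrix.of_apply]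
      by_cases h1 : rc x ∈ B <;> by_cases h2 : cc y ∈ B <;> by_cases h3 : pr x <;> by_cases h4 : pc y <;> simp [h1, h2, h3, h4]
    have e2 : (Matrix.of fun x y => if rc x ∉ B ∧ cc y ∈ B then R x y else 0) =
        Matrix.of fun x y => if (pr x ∧ rc x ∉ B) ∧ (pc y ∧ cc y ∈ B) then E x y else 0 := by
      ext x y; simp only [hR, Matrix.of_apply]
      by_cases h1 : rc x ∈ B <;> by_cases h2 : cc y ∈ B <;> by_cases h3 : pr x <;> by_cases h4 : pc y <;> simp [h1, h2, h3, h4]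
    rw [e1, e2]
    have := hcut B
    omega
  obtain ⟨R', hR'0, hR'rank⟩ := exists_blockDiagonal_of_cuts_le rc cc R (2 * c) hc2
  refine ⟨R - R', hR'rank.trans (le_of_eq (by ring)), fun x y hxy => ?_⟩
  rw [Matrix.sub_apply, hR'0 x y hxy, sub_zero]
  simp only [hR, Matrix.of_apply]

/-- **STRIP COMPLETION** (registered stub `stub_stripCompletion` of `Lines/rank_dehn_ladder.lean`, RESHAPE 6): if all double
bipartition cuts of `E` are `≤ c` and `E` vanishes at every visible entry off four label strips (`PI, QJ` for rows, `PI′, QJ′` for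
columns, each of `≤ m` classes), then some `L` of rank `≤ 32·m·c` agrees with `E` at every visible entry. -/
theorem stub_stripCompletion :
    ∀ (K : Type) [Field K] (n n' : ℕ) (ι ι' : Type) [Fintype ι] [Fintype ι'] [DecidableEq ι] [DecidableEq ι']
      (row : ι → Fin n ⊕ Fin n' → Bool) (col : ι' → Fin n ⊕ Fin n' → Bool) (E : Matrix ι ι' K) (c m : ℕ)
      (PI PI' : Finset (Fin n → Bool)) (QJ QJ' : Finset (Fin n' → Bool)),
      (∀ B B', doubleCut row col B B' E ≤ c) →
      PI.card ≤ m → PI'.card ≤ m → QJ.card ≤ m → QJ'.card ≤ m →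
      (∀ x y, colourI (row x) ≠ colourI (col y) → colourJ (row x) ≠ colourJ (col y) →
          colourI (row x) ∉ PI → colourJ (row x) ∉ QJ → colourI (col y) ∉ PI' → colourJ (col y) ∉ QJ' →
          E x y = 0) →
      ∃ L : Matrix ι ι' K, L.rank ≤ 32 * m * c ∧
        ∀ x y, colourI (row x) ≠ colourI (col y) → colourJ (row x) ≠ colourJ (col y) → L x y = E x y := by
  intro K _ n n' ι ι' _ _ _ _ row col E c m PI PI' QJ QJ' hc hPI hPI' hQJ hQJ' hvan
  classical
  -- abbreviations
  let cIr : ι → (Fin n → Bool) := fun x => colourI (row x)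
  let cJr : ι → (Fin n' → Bool) := fun x => colourJ (row x)
  let cIc : ι' → (Fin n → Bool) := fun y => colourI (col y)
  let cJc : ι' → (Fin n' → Bool) := fun y => colourJ (col y)
  let offR : ι → Prop := fun x => cIr x ∉ PI ∧ cJr x ∉ QJ
  -- (1) row strips of the first family: rows of I-class `p₁`, columns of the other I-classes, coloured by the second family
  have h1 : ∀ p₁ : Fin n → Bool, ∃ L : Matrix ι ι' K, L.rank ≤ 8 * c ∧
      ∀ x y, cJr x ≠ cJc y → L x y = if cIr x = p₁ ∧ cIc y ≠ p₁ then E x y else 0 := by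
    intro p₁
    refine exists_piece E cJr cJc (fun x => cIr x = p₁) (fun y => cIc y ≠ p₁) c fun B' => ⟨?_, ?_⟩
    · refine (rank_block_le_doubleCut row col E {p₁} B' true true _ _ ?_ ?_).trans (hc {p₁} B')
      · rintro x ⟨hx, hB⟩; simp [cIr, cJr] at hx hB ⊢; simp [hx, hB]
      · rintro y ⟨hy, hB⟩; simp [cIc, cJc] at hy hB ⊢; simp [hy, hB]
    · refine (rank_block_le_doubleCut row col E {p₁} B' true false _ _ ?_ ?_).trans (hc {p₁} B')
      · rintro x ⟨hx, hB⟩; simp [cIr, cJr] at hx hB ⊢; simp [hx, hB]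
      · rintro y ⟨hy, hB⟩; simp [cIc, cJc] at hy hB ⊢; simp [hy, hB]
  -- (2) row strips of the second family, off the first-family row strips, coloured by the first family
  have h2 : ∀ q₁ : Fin n' → Bool, ∃ L : Matrix ι ι' K, L.rank ≤ 8 * c ∧
      ∀ x y, cIr x ≠ cIc y → L x y = if (cJr x = q₁ ∧ cIr x ∉ PI) ∧ cJc y ≠ q₁ then E x y else 0 := by
    intro q₁
    refine exists_piece E cIr cIc (fun x => cJr x = q₁ ∧ cIr x ∉ PI) (fun y => cJc y ≠ q₁) c fun B => ⟨?_, ?_⟩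
    · refine (rank_block_le_doubleCut row col E B {q₁} true true _ _ ?_ ?_).trans (hc B {q₁})
      · rintro x ⟨⟨hx, -⟩, hB⟩; simp [cIr, cJr] at hx hB ⊢; simp [hx, hB]
      · rintro y ⟨hy, hB⟩; simp [cIc, cJc] at hy hB ⊢; simp [hy, hB]
    · refine (rank_block_le_doubleCut row col E B {q₁} false true _ _ ?_ ?_).trans (hc B {q₁})
      · rintro x ⟨⟨hx, -⟩, hB⟩; simp [cIr, cJr] at hx hB ⊢; simp [hx, hB]
      · rintro y ⟨hy, hB⟩; simp [cIc, cJc] at hy hB ⊢; simp [hy, hB]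
  -- (3) column strips of the first family, rows off the row strips, coloured by the second family
  have h3 : ∀ p₂ : Fin n → Bool, ∃ L : Matrix ι ι' K, L.rank ≤ 8 * c ∧
      ∀ x y, cJr x ≠ cJc y → L x y = if (offR x ∧ cIr x ≠ p₂) ∧ cIc y = p₂ then E x y else 0 := by
    intro p₂
    refine exists_piece E cJr cJc (fun x => offR x ∧ cIr x ≠ p₂) (fun y => cIc y = p₂) c fun B' => ⟨?_, ?_⟩
    · refine (rank_block_le_doubleCut row col E {p₂} B' false true _ _ ?_ ?_).trans (hc {p₂} B')
      · rintro x ⟨⟨-, hx⟩, hB⟩; simp [cIr, cJr] at hx hB ⊢; simp [hx, hB]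
      · rintro y ⟨hy, hB⟩; simp [cIc, cJc] at hy hB ⊢; simp [hy, hB]
    · refine (rank_block_le_doubleCut row col E {p₂} B' false false _ _ ?_ ?_).trans (hc {p₂} B')
      · rintro x ⟨⟨-, hx⟩, hB⟩; simp [cIr, cJr] at hx hB ⊢; simp [hx, hB]
      · rintro y ⟨hy, hB⟩; simp [cIc, cJc] at hy hB ⊢; simp [hy, hB]
  -- (4) column strips of the second family (off `PI′` columns), rows off the row strips, coloured by the first family
  have h4 : ∀ q₂ : Fin n' → Bool, ∃ L : Matrix ι ι' K, L.rank ≤ 8 * c ∧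
      ∀ x y, cIr x ≠ cIc y → L x y = if (offR x ∧ cJr x ≠ q₂) ∧ (cJc y = q₂ ∧ cIc y ∉ PI') then E x y else 0 := by
    intro q₂
    refine exists_piece E cIr cIc (fun x => offR x ∧ cJr x ≠ q₂) (fun y => cJc y = q₂ ∧ cIc y ∉ PI') c
      fun B => ⟨?_, ?_⟩
    · refine (rank_block_le_doubleCut row col E B {q₂} true false _ _ ?_ ?_).trans (hc B {q₂})
      · rintro x ⟨⟨-, hx⟩, hB⟩; simp [cIr, cJr] at hx hB ⊢; simp [hx, hB]
      · rintro y ⟨⟨hy, -⟩, hB⟩; simp [cIc, cJc] at hy hB ⊢; simp [hy, hB]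
    · refine (rank_block_le_doubleCut row col E B {q₂} false false _ _ ?_ ?_).trans (hc B {q₂})
      · rintro x ⟨⟨-, hx⟩, hB⟩; simp [cIr, cJr] at hx hB ⊢; simp [hx, hB]
      · rintro y ⟨⟨hy, -⟩, hB⟩; simp [cIc, cJc] at hy hB ⊢; simp [hy, hB]
  choose L1 hL1r hL1 using h1
  choose L2 hL2r hL2 using h2
  choose L3 hL3r hL3 using h3
  choose L4 hL4r hL4 using h4
  refine ⟨(∑ p₁ ∈ PI, L1 p₁) + (∑ q₁ ∈ QJ, L2 q₁) + (∑ p₂ ∈ PI', L3 p₂) + (∑ q₂ ∈ QJ', L4 q₂), ?_, ?_⟩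
  · -- rank bound: (#PI + #QJ + #PI' + #QJ') · 8c ≤ 32 m c
    have r1 : (∑ p₁ ∈ PI, L1 p₁).rank ≤ PI.card * (8 * c) :=
      (rank_sum_le' PI L1).trans (by
        calc ∑ p₁ ∈ PI, (L1 p₁).rank ≤ ∑ _p₁ ∈ PI, 8 * c := Finset.sum_le_sum fun p _ => hL1r p
          _ = PI.card * (8 * c) := by simp)
    have r2 : (∑ q₁ ∈ QJ, L2 q₁).rank ≤ QJ.card * (8 * c) :=
      (rank_sum_le' QJ L2).trans (by
        calc ∑ q₁ ∈ QJ, (L2 q₁).rank ≤ ∑ _q₁ ∈ QJ, 8 * c := Finset.sum_le_sum fun q _ => hL2r q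
          _ = QJ.card * (8 * c) := by simp)
    have r3 : (∑ p₂ ∈ PI', L3 p₂).rank ≤ PI'.card * (8 * c) :=
      (rank_sum_le' PI' L3).trans (by
        calc ∑ p₂ ∈ PI', (L3 p₂).rank ≤ ∑ _p₂ ∈ PI', 8 * c := Finset.sum_le_sum fun p _ => hL3r p
          _ = PI'.card * (8 * c) := by simp)
    have r4 : (∑ q₂ ∈ QJ', L4 q₂).rank ≤ QJ'.card * (8 * c) :=
      (rank_sum_le' QJ' L4).trans (by
        calc ∑ q₂ ∈ QJ', (L4 q₂).rank ≤ ∑ _q₂ ∈ QJ', 8 * c := Finset.sum_le_sum fun q _ => hL4r q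
          _ = QJ'.card * (8 * c) := by simp)
    have e := (rank_add_le' _ _).trans (Nat.add_le_add ((rank_add_le' _ _).trans (Nat.add_le_add
      ((rank_add_le' _ _).trans (Nat.add_le_add r1 r2)) r3)) r4)
    refine e.trans ?_
    have : PI.card * (8 * c) + QJ.card * (8 * c) + PI'.card * (8 * c) + QJ'.card * (8 * c) ≤
        m * (8 * c) + m * (8 * c) + m * (8 * c) + m * (8 * c) := by
      gcongr
    refine this.trans (le_of_eq ?_)
    ring
  · intro x y hI hJ
    simp only [Matrix.add_apply, Matrix.sum_apply]
    rw [Finset.sum_congr rfl fun p₁ _ => hL1 p₁ x y hJ, Finset.sum_congr rfl fun q₁ _ => hL2 q₁ x y hI,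
      Finset.sum_congr rfl fun p₂ _ => hL3 p₂ x y hJ, Finset.sum_congr rfl fun q₂ _ => hL4 q₂ x y hI]
    -- evaluate the four sums
    have s1 : (∑ p₁ ∈ PI, if cIr x = p₁ ∧ cIc y ≠ p₁ then E x y else 0) = if cIr x ∈ PI then E x y else 0 := by
      rw [Finset.sum_congr rfl fun p₁ _ => show (if cIr x = p₁ ∧ cIc y ≠ p₁ then E x y else 0) =
          (if cIr x = p₁ then E x y else 0) by
            by_cases h : cIr x = p₁
            · have : cIc y ≠ p₁ := fun h' => hI (h.trans h'.symm); simp [h, this]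
            · simp [h]]
      exact Finset.sum_ite_eq PI (cIr x) (fun _ => E x y)
    have s2 : (∑ q₁ ∈ QJ, if (cJr x = q₁ ∧ cIr x ∉ PI) ∧ cJc y ≠ q₁ then E x y else 0) =
        if cJr x ∈ QJ ∧ cIr x ∉ PI then E x y else 0 := by
      rw [Finset.sum_congr rfl fun q₁ _ => show (if (cJr x = q₁ ∧ cIr x ∉ PI) ∧ cJc y ≠ q₁ then E x y else 0) =
          (if cJr x = q₁ then (if cIr x ∉ PI then E x y else 0) else 0) by
            by_cases h : cJr x = q₁
            · have : cJc y ≠ q₁ := fun h' => hJ (h.trans h'.symm)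
              by_cases h'' : cIr x ∈ PI <;> simp [h, this, h'']
            · simp [h]]
      rw [Finset.sum_ite_eq QJ (cJr x)]
      by_cases h'' : cIr x ∈ PI <;> by_cases h3 : cJr x ∈ QJ <;> simp [h'', h3]
    have s3 : (∑ p₂ ∈ PI', if (offR x ∧ cIr x ≠ p₂) ∧ cIc y = p₂ then E x y else 0) =
        if offR x ∧ cIc y ∈ PI' then E x y else 0 := by
      rw [Finset.sum_congr rfl fun p₂ _ => show (if (offR x ∧ cIr x ≠ p₂) ∧ cIc y = p₂ then E x y else 0) =
          (if cIc y = p₂ then (if offR x then E x y else 0) else 0) by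
            by_cases h : cIc y = p₂
            · have : cIr x ≠ p₂ := fun h' => hI (h'.trans h.symm)
              by_cases h'' : offR x <;> simp [h, this, h'']
            · simp [h]]
      rw [Finset.sum_ite_eq PI' (cIc y)]
      by_cases h'' : offR x <;> by_cases h3 : cIc y ∈ PI' <;> simp [h'', h3]
    have s4 : (∑ q₂ ∈ QJ', if (offR x ∧ cJr x ≠ q₂) ∧ (cJc y = q₂ ∧ cIc y ∉ PI') then E x y else 0) =
        if offR x ∧ (cJc y ∈ QJ' ∧ cIc y ∉ PI') then E x y else 0 := by
      rw [Finset.sum_congr rfl fun q₂ _ => show (if (offR x ∧ cJr x ≠ q₂) ∧ (cJc y = q₂ ∧ cIc y ∉ PI') then E x y else 0) =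
          (if cJc y = q₂ then (if offR x ∧ cIc y ∉ PI' then E x y else 0) else 0) by
            by_cases h : cJc y = q₂
            · have : cJr x ≠ q₂ := fun h' => hJ (h'.trans h.symm)
              by_cases h'' : offR x <;> by_cases h4 : cIc y ∈ PI' <;> simp [h, this, h'', h4]
            · simp [h]]
      rw [Finset.sum_ite_eq QJ' (cJc y)]
      by_cases h'' : offR x <;> by_cases h3 : cJc y ∈ QJ' <;> by_cases h4 : cIc y ∈ PI' <;> simp [h'', h3, h4]
    rw [s1, s2, s3, s4]
    -- case analysis on the strip memberships
    by_cases a1 : cIr x ∈ PI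
    · have : ¬ offR x := fun h => h.1 a1
      simp [a1, this]
    · by_cases a2 : cJr x ∈ QJ
      · have : ¬ offR x := fun h => h.2 a2
        simp [a1, a2, this]
      · have ho : offR x := ⟨a1, a2⟩
        by_cases a3 : cIc y ∈ PI'
        · simp [a1, a2, ho, a3]
        · by_cases a4 : cJc y ∈ QJ'
          · simp [a1, a2, ho, a3, a4]
          · have hz : E x y = 0 := hvan x y hI hJ a1 a2 a3 a4
            simp [a1, a2, a3, a4, hz]

end Strips

end Summit.PneNP.PneNP.Theorems.CnfIdealGenLengthRankDefectRepresentationsStripCompletion
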